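import Literature.Computability.Complexity.BoundedArithmetic
import HarnessLib

/-!
# Buss's conservation theorem `S₂ⁱ⁺¹ ≤_{∀Σᵇᵢ₊₁} T₂ⁱ`: model-theoretic form and reduction

Trunk: CplxMeta / family `pnp` (support for the named fact
`Literature.Computability.Complexity.S2_succ_isConservativeOver_T2` of `Literature/Computability/Complexity/BoundedArithmetic.lean`).

Buss's theorem (Buss 1990, Thm. 5; Krajíček 1995, Cor. 7.2.4): for `i ≥ 1`, every `∀Σᵇᵢ₊₁`
sentence provable in `S₂ⁱ⁺¹` is provable in `T₂ⁱ`.  Its published proofs are either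
proof-theoretic (Buss 1990, §§3–5: free-cut elimination and the witnessing Theorem 17) or
model-theoretic (Wilkie, unpublished; Zambella 1996; Krajíček 1995, Thm. 7.6.3 and pp. 116–117;
Avigad 2002, §4): every (countable) model of the universal theory `PVᵢ₊₁ ⊇ T₂ⁱ` has a
`Σᵇᵢ₊₁`-elementary extension to a model of `S₂ⁱ⁺¹(PVᵢ₊₁)`, whence conservativity by compactness.

This file isolates the *model-theoretic form* of the theorem in the language of bounded
arithmetic itself and proves, inside Mathlib's `FirstOrder` library (provability = semantic
consequence `⊨ᵇ`), that it is **equivalent** to the conservativity statement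
`S2_succ_isConservativeOver_T2`:

* `Literature.CplxMeta.PreservesPib i f`: the map `f : M → N` preserves all `Πᵇᵢ` formulas (with
  parameters, i.e. under every assignment of the free variables in `M`).  For `i` arbitrary this
  forces `f` to be an embedding (`PreservesPib.toEmbedding`).
* `Literature.Computability.Complexity.T2_hasPibPreservingMap_S2_succ` (named fact): for `i ≥ 1`, every model of `T₂ⁱ` maps
  `Πᵇᵢ₊₁`-preservingly into a model of `S₂ⁱ⁺¹` [Buss 1990, Thm. 5, in model-theoretic form;
  Krajíček 1995, Thm. 7.6.3 / Zambella 1996 prove this form (for `PVᵢ₊₁`-structures)].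
* `Literature.Computability.Complexity.S2_succ_isConservativeOver_T2_of_hasPibPreservingMap` (proved): the fact implies
  `S2_succ_isConservativeOver_T2`.
* `Literature.Computability.Complexity.t2_hasPibPreservingMap_S2_succ_of_isConservativeOver` (proved, compactness and the
  `Πᵇᵢ₊₁`-diagram): the converse; together `t2_hasPibPreservingMap_S2_succ_iff`.

On the way we provide the reindexing operation `BoundedFormula.reindex` of the in-context
variables of a bounded formula and show that Buss's classes (sharply bounded, `Σᵇᵢ`, `Πᵇᵢ`) are
stable under it (`IsSigmab.reindex`, `IsPib.reindex`), and that `Πᵇᵢ₊₁` is closed under finite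
conjunctions.

## References

* S. R. Buss, *Axiomatizations and conservation results for fragments of bounded arithmetic*, in:
  Logic and Computation, Contemp. Math. 106, AMS 1990, 57–84: Thm. 5 ("`S₂ⁱ⁺¹` is
  `∀Σᵇᵢ₊₁`-conservative over `T₂ⁱ`", `i ≥ 1`) and its proof from Thm. 17 (§5).
* J. Krajíček, *Bounded Arithmetic, Propositional Logic and Complexity Theory*, CUP 1995:
  Cor. 7.2.4 (p. 100), Thm. 5.3.5 (p. 74), Thm. 7.6.3 and the derivation of Cor. 7.2.4 following
  Zambella (pp. 116–117).
* D. Zambella, *Notes on polynomially bounded arithmetic*, J. Symbolic Logic 61 (1996), 942–966.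
* J. Avigad, *Saturated models of universal theories*, Ann. Pure Appl. Logic 118 (2002), §4.

## Design choices

* Formulas "with parameters from `M`" are represented, exactly as in `IsForallSigmab` and in
  Mathlib's `⊨ᵇ`, by bounded formulas `φ : L.BoundedFormula Empty n` evaluated at a tuple
  `xs : Fin n → M`; preservation along `f` means `φ(xs) → φ(f ∘ xs)`.  This avoids constants.
* The named fact quantifies over structures in `Type` (= the universe of Mathlib's models of
  `Language.boundedArith`-theories in `⊨ᵇ`); no generality is lost (Löwenheim–Skolem), and the
  equivalence with conservativity is proved in this universe.
* The converse direction is the standard diagram argument: a model of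
  `S₂ⁱ⁺¹ ∪ Diag_{Πᵇᵢ₊₁}(M)` exists by compactness, a finite failure producing a `∀Σᵇᵢ₊₁`
  consequence of `S₂ⁱ⁺¹` false in `M ⊨ T₂ⁱ`.
-/

open FirstOrder FirstOrder.Language FirstOrder.Language.BoundedFormula

namespace Literature.Computability.Complexity

/-! ## Reindexing the in-context variables of a bounded formula -/

section Reindex

variable {L : Language} {α : Type*}

/-- Extend a reindexing `ι : Fin n → Fin m` of context variables under one more binder: the new
last variable is sent to the new last variable. [folklore] -/
def liftIndex {n m : ℕ} (ι : Fin n → Fin m) : Fin (n + 1) → Fin (m + 1) :=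
  Fin.snoc (fun k => Fin.castSucc (ι k)) (Fin.last m)

/-- `liftIndex` on an old variable. [folklore] -/
@[simp] theorem liftIndex_castSucc {n m : ℕ} (ι : Fin n → Fin m) (k : Fin n) :
    liftIndex ι (Fin.castSucc k) = Fin.castSucc (ι k) := by
  simp [liftIndex]

/-- `liftIndex` on the new last variable. [folklore] -/
@[simp] theorem liftIndex_last {n m : ℕ} (ι : Fin n → Fin m) :
    liftIndex ι (Fin.last n) = Fin.last m := by
  simp [liftIndex]

/-- `liftIndex ι` extends `ι`. [folklore] -/
theorem liftIndex_comp_castSucc {n m : ℕ} (ι : Fin n → Fin m) :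
    liftIndex ι ∘ Fin.castSucc = Fin.castSucc ∘ ι := funext (liftIndex_castSucc ι)

/-- Composing an extended assignment with a lifted reindexing. [folklore] -/
theorem snoc_comp_liftIndex {M : Type*} {n m : ℕ} (ι : Fin n → Fin m) (xs : Fin m → M) (a : M) :
    (Fin.snoc xs a : Fin (m + 1) → M) ∘ liftIndex ι = Fin.snoc (xs ∘ ι) a := by
  ext k
  cases k using Fin.lastCases with
  | last => simp
  | cast k => simp

/-- Reindex the in-context (`Fin n`) variables of a bounded formula along `ι : Fin n → Fin m`
(a renaming of the variables `x₀,…,xₙ₋₁ ↦ x_{ι 0},…,x_{ι (n-1)}`; bound variables introduced by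
quantifiers inside the formula are untouched).  Generalises Mathlib's `BoundedFormula.castLE`
(the case of an initial-segment inclusion). [folklore] -/
def _root_.FirstOrder.Language.BoundedFormula.reindex :
    ∀ {n m : ℕ} (_ι : Fin n → Fin m), L.BoundedFormula α n → L.BoundedFormula α m
  | _, _, _, falsum => falsum
  | _, _, ι, equal t₁ t₂ => equal (t₁.relabel (Sum.map id ι)) (t₂.relabel (Sum.map id ι))
  | _, _, ι, rel R ts => rel R fun j => (ts j).relabel (Sum.map id ι)
  | _, _, ι, imp φ ψ => (φ.reindex ι).imp (ψ.reindex ι)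
  | _, _, ι, all φ => (φ.reindex (liftIndex ι)).all

variable {n m : ℕ} (ι : Fin n → Fin m)

/-- Reindexing `⊥`. [folklore] -/
@[simp] theorem reindex_falsum : (falsum : L.BoundedFormula α n).reindex ι = falsum := rfl

/-- Reindexing `⊥`. [folklore] -/
@[simp] theorem reindex_bot : (⊥ : L.BoundedFormula α n).reindex ι = ⊥ := rfl

/-- Reindexing an equation. [folklore] -/
@[simp] theorem reindex_equal (t₁ t₂ : L.Term (α ⊕ Fin n)) :
    (equal t₁ t₂ : L.BoundedFormula α n).reindex ι =
      equal (t₁.relabel (Sum.map id ι)) (t₂.relabel (Sum.map id ι)) := rfl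

/-- Reindexing an atomic relation. [folklore] -/
@[simp] theorem reindex_rel {l : ℕ} (R : L.Relations l) (ts : Fin l → L.Term (α ⊕ Fin n)) :
    (rel R ts : L.BoundedFormula α n).reindex ι = rel R fun j => (ts j).relabel (Sum.map id ι) :=
  rfl

/-- Reindexing an implication. [folklore] -/
@[simp] theorem reindex_imp (φ ψ : L.BoundedFormula α n) :
    (φ.imp ψ).reindex ι = (φ.reindex ι).imp (ψ.reindex ι) := rfl

/-- Reindexing a universal quantification. [folklore] -/
@[simp] theorem reindex_all (φ : L.BoundedFormula α (n + 1)) :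
    φ.all.reindex ι = (φ.reindex (liftIndex ι)).all := rfl

/-- Reindexing a negation. [folklore] -/
@[simp] theorem reindex_not (φ : L.BoundedFormula α n) : (∼φ).reindex ι = ∼(φ.reindex ι) := rfl

/-- Reindexing a conjunction. [folklore] -/
@[simp] theorem reindex_inf (φ ψ : L.BoundedFormula α n) :
    (φ ⊓ ψ).reindex ι = φ.reindex ι ⊓ ψ.reindex ι := rfl

/-- Reindexing a disjunction. [folklore] -/
@[simp] theorem reindex_sup (φ ψ : L.BoundedFormula α n) :
    (φ ⊔ ψ).reindex ι = φ.reindex ι ⊔ ψ.reindex ι := rfl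

/-- Reindexing an existential quantification. [folklore] -/
@[simp] theorem reindex_ex (φ : L.BoundedFormula α (n + 1)) :
    φ.ex.reindex ι = (φ.reindex (liftIndex ι)).ex := rfl

/-- Semantics of reindexing: evaluate the original formula at the reindexed assignment.
[folklore] -/
@[simp] theorem realize_reindex {M : Type*} [L.Structure M] :
    ∀ {n m : ℕ} (ι : Fin n → Fin m) (φ : L.BoundedFormula α n) (v : α → M) (xs : Fin m → M),
      (φ.reindex ι).Realize v xs ↔ φ.Realize v (xs ∘ ι)
  | _, _, ι, falsum, v, xs => Iff.rfl
  | _, _, ι, equal t₁ t₂, v, xs => by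
    simp [Realize, Term.realize_relabel, Sum.elim_comp_map]
  | _, _, ι, rel R ts, v, xs => by
    simp [Realize, Term.realize_relabel, Sum.elim_comp_map]
  | _, _, ι, imp φ ψ, v, xs => by
    simp only [reindex_imp, realize_imp, realize_reindex ι φ, realize_reindex ι ψ]
  | _, _, ι, all φ, v, xs => by
    simp only [reindex_all, realize_all]
    refine forall_congr' fun a => ?_
    rw [realize_reindex (liftIndex ι) φ, snoc_comp_liftIndex]

/-- Quantifier-free formulas are stable under reindexing. [folklore] -/
theorem _root_.FirstOrder.Language.BoundedFormula.IsQF.reindex {φ : L.BoundedFormula α n}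
    (h : φ.IsQF) (ι : Fin n → Fin m) : (φ.reindex ι).IsQF := by
  induction h with
  | falsum => exact IsQF.falsum
  | of_isAtomic h =>
    cases h with
    | equal t₁ t₂ => exact (IsAtomic.equal _ _).isQF
    | rel R ts => exact (IsAtomic.rel _ _).isQF
  | imp _ _ ih₁ ih₂ => exact ih₁.imp ih₂

end Reindex

/-! ## Buss's classes are stable under reindexing -/

section ReindexClasses

variable {α : Type} {n m : ℕ}

/-- Relabelling a term twice. [folklore] -/
private theorem relabel_castSucc_relabel_liftIndex {L : Language} (ι : Fin n → Fin m)
    (t : L.Term (α ⊕ Fin n)) :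
    (t.relabel (Sum.map id Fin.castSucc)).relabel (Sum.map id (liftIndex ι)) =
      (t.relabel (Sum.map id ι)).relabel (Sum.map id (Fin.castSucc : Fin m → Fin (m + 1))) := by
  rw [Term.relabel_relabel, Term.relabel_relabel]
  congr 1
  ext x
  rcases x with a | k <;> simp

/-- Reindexing commutes with the bounded universal quantifier. [folklore] -/
@[simp] theorem reindex_ballLE {L : Language} [L.IsOrdered] (ι : Fin n → Fin m)
    (t : L.Term (α ⊕ Fin n)) (φ : L.BoundedFormula α (n + 1)) :
    (MetaComplexity.ballLE t φ).reindex ι = MetaComplexity.ballLE (t.relabel (Sum.map id ι)) (φ.reindex (liftIndex ι)) := by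
  simp only [MetaComplexity.ballLE, reindex_all, reindex_imp]
  congr 2
  simp only [Term.le, Relations.boundedFormula₂, Relations.boundedFormula, reindex_rel]
  congr 1
  ext j : 1
  fin_cases j
  · simp [Term.relabel]
  · simpa using relabel_castSucc_relabel_liftIndex ι t

/-- Reindexing commutes with the bounded existential quantifier. [folklore] -/
@[simp] theorem reindex_bexLE {L : Language} [L.IsOrdered] (ι : Fin n → Fin m)
    (t : L.Term (α ⊕ Fin n)) (φ : L.BoundedFormula α (n + 1)) :
    (MetaComplexity.bexLE t φ).reindex ι = MetaComplexity.bexLE (t.relabel (Sum.map id ι)) (φ.reindex (liftIndex ι)) := by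
  simp only [MetaComplexity.bexLE, reindex_ex, reindex_inf]
  congr 2
  simp only [Term.le, Relations.boundedFormula₂, Relations.boundedFormula, reindex_rel]
  congr 1
  ext j : 1
  fin_cases j
  · simp [Term.relabel]
  · simpa using relabel_castSucc_relabel_liftIndex ι t

/-- Relabelling commutes with the length term former `|·|`. [folklore] -/
@[simp] theorem relabel_term_len {β γ : Type} (g : β → γ) (t : Language.boundedArith.Term β) :
    (MetaComplexity.Term.len t).relabel g = MetaComplexity.Term.len (t.relabel g) := by
  simp only [MetaComplexity.Term.len, Functions.apply₁, Term.relabel]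
  congr 1
  funext j
  fin_cases j
  rfl

/-- Reindexing commutes with the sharply bounded universal quantifier. [folklore] -/
@[simp] theorem reindex_ballLELen (ι : Fin n → Fin m)
    (t : Language.boundedArith.Term (α ⊕ Fin n))
    (φ : Language.boundedArith.BoundedFormula α (n + 1)) :
    (MetaComplexity.ballLELen t φ).reindex ι = MetaComplexity.ballLELen (t.relabel (Sum.map id ι)) (φ.reindex (liftIndex ι)) := by
  simp only [MetaComplexity.ballLELen, reindex_ballLE, relabel_term_len]

/-- Reindexing commutes with the sharply bounded existential quantifier. [folklore] -/
@[simp] theorem reindex_bexLELen (ι : Fin n → Fin m)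
    (t : Language.boundedArith.Term (α ⊕ Fin n))
    (φ : Language.boundedArith.BoundedFormula α (n + 1)) :
    (MetaComplexity.bexLELen t φ).reindex ι = MetaComplexity.bexLELen (t.relabel (Sum.map id ι)) (φ.reindex (liftIndex ι)) := by
  simp only [MetaComplexity.bexLELen, reindex_bexLE, relabel_term_len]

/-- Sharply bounded formulas are stable under reindexing of the context variables
(Buss 1986, §2.1: the classes are closed under substitution of terms/variables). [cite: Buss1986, §2.1] -/
theorem _root_.Literature.Computability.MetaComplexity.IsSharplyBounded.reindex {φ : Language.boundedArith.BoundedFormula α n}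
    (h : MetaComplexity.IsSharplyBounded φ) : ∀ {m : ℕ} (ι : Fin n → Fin m), MetaComplexity.IsSharplyBounded (φ.reindex ι) := by
  induction h with
  | of_isQF h => exact fun ι => .of_isQF (h.reindex ι)
  | imp _ _ ih₁ ih₂ => exact fun ι => .imp (ih₁ ι) (ih₂ ι)
  | ballLELen t _ ih =>
    intro m ι
    rw [reindex_ballLELen]
    exact .ballLELen _ (ih _)
  | bexLELen t _ ih =>
    intro m ι
    rw [reindex_bexLELen]
    exact .bexLELen _ (ih _)

/-- `Σᵇᵢ` and `Πᵇᵢ` are stable under reindexing of the context variables (Buss 1986, §2.1: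
the classes are closed under renaming/substitution of free variables). [cite: Buss1986, §2.1] -/
theorem _root_.Literature.Computability.MetaComplexity.IsSigmab.reindex_and_IsPib_reindex (i : ℕ) :
    (∀ {n : ℕ} {φ : Language.boundedArith.BoundedFormula α n}, MetaComplexity.IsSigmab i φ →
      ∀ {m : ℕ} (ι : Fin n → Fin m), MetaComplexity.IsSigmab i (φ.reindex ι)) ∧
    (∀ {n : ℕ} {φ : Language.boundedArith.BoundedFormula α n}, MetaComplexity.IsPib i φ →
      ∀ {m : ℕ} (ι : Fin n → Fin m), MetaComplexity.IsPib i (φ.reindex ι)) := by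
  constructor
  · intro n φ h
    refine MetaComplexity.IsSigmab.rec
      (motive_1 := fun i n φ _ => ∀ {m : ℕ} (ι : Fin n → Fin m), MetaComplexity.IsSigmab i (φ.reindex ι))
      (motive_2 := fun i n φ _ => ∀ {m : ℕ} (ι : Fin n → Fin m), MetaComplexity.IsPib i (φ.reindex ι))
      ?_ ?_ ?_ ?_ ?_ ?_ ?_ ?_ ?_ ?_ h
    · exact fun h _ ι => .of_isSharplyBounded (h.reindex ι)
    · exact fun _ ih _ ι => .of_isPib (ih ι)
    · exact fun _ _ ih₁ ih₂ _ ι => .imp (ih₁ ι) (ih₂ ι)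
    · intro i n t φ _ ih m ι
      rw [reindex_bexLE]
      exact .bexLE _ (ih _)
    · intro i n t φ _ ih m ι
      rw [reindex_ballLELen]
      exact .ballLELen _ (ih _)
    · exact fun h _ ι => .of_isSharplyBounded (h.reindex ι)
    · exact fun _ ih _ ι => .of_isSigmab (ih ι)
    · exact fun _ _ ih₁ ih₂ _ ι => .imp (ih₁ ι) (ih₂ ι)
    · intro i n t φ _ ih m ι
      rw [reindex_ballLE]
      exact .ballLE _ (ih _)
    · intro i n t φ _ ih m ι
      rw [reindex_bexLELen]
      exact .bexLELen _ (ih _)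
  · intro n φ h
    refine MetaComplexity.IsPib.rec
      (motive_1 := fun i n φ _ => ∀ {m : ℕ} (ι : Fin n → Fin m), MetaComplexity.IsSigmab i (φ.reindex ι))
      (motive_2 := fun i n φ _ => ∀ {m : ℕ} (ι : Fin n → Fin m), MetaComplexity.IsPib i (φ.reindex ι))
      ?_ ?_ ?_ ?_ ?_ ?_ ?_ ?_ ?_ ?_ h
    · exact fun h _ ι => .of_isSharplyBounded (h.reindex ι)
    · exact fun _ ih _ ι => .of_isPib (ih ι)
    · exact fun _ _ ih₁ ih₂ _ ι => .imp (ih₁ ι) (ih₂ ι)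
    · intro i n t φ _ ih m ι
      rw [reindex_bexLE]
      exact .bexLE _ (ih _)
    · intro i n t φ _ ih m ι
      rw [reindex_ballLELen]
      exact .ballLELen _ (ih _)
    · exact fun h _ ι => .of_isSharplyBounded (h.reindex ι)
    · exact fun _ ih _ ι => .of_isSigmab (ih ι)
    · exact fun _ _ ih₁ ih₂ _ ι => .imp (ih₁ ι) (ih₂ ι)
    · intro i n t φ _ ih m ι
      rw [reindex_ballLE]
      exact .ballLE _ (ih _)
    · intro i n t φ _ ih m ι
      rw [reindex_bexLELen]
      exact .bexLELen _ (ih _)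

/-- `Σᵇᵢ` is stable under reindexing of the context variables (Buss 1986, §2.1). [cite: Buss1986, §2.1] -/
theorem _root_.Literature.Computability.MetaComplexity.IsSigmab.reindex {i : ℕ} {φ : Language.boundedArith.BoundedFormula α n}
    (h : MetaComplexity.IsSigmab i φ) (ι : Fin n → Fin m) : MetaComplexity.IsSigmab i (φ.reindex ι) :=
  (MetaComplexity.IsSigmab.reindex_and_IsPib_reindex i).1 h ι

/-- `Πᵇᵢ` is stable under reindexing of the context variables (Buss 1986, §2.1). [cite: Buss1986, §2.1] -/
theorem _root_.Literature.Computability.MetaComplexity.IsPib.reindex {i : ℕ} {φ : Language.boundedArith.BoundedFormula α n}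
    (h : MetaComplexity.IsPib i φ) (ι : Fin n → Fin m) : MetaComplexity.IsPib i (φ.reindex ι) :=
  (MetaComplexity.IsSigmab.reindex_and_IsPib_reindex i).2 h ι

/-- `Πᵇᵢ₊₁` is closed under `∧` (Buss 1986, §2.1); on Mathlib syntax `φ ⊓ ψ = ∼(φ ⟹ ∼ψ)`. [cite: Buss1986, §2.1] -/
theorem _root_.Literature.Computability.MetaComplexity.IsPib.inf {i : ℕ} {φ ψ : Language.boundedArith.BoundedFormula α n}
    (hφ : MetaComplexity.IsPib (i + 1) φ) (hψ : MetaComplexity.IsPib (i + 1) ψ) : MetaComplexity.IsPib (i + 1) (φ ⊓ ψ) :=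
  (MetaComplexity.IsSigmab.imp hφ hψ.not).not

/-- `⊤` is `Πᵇᵢ` (it is quantifier-free). [folklore] -/
theorem _root_.Literature.Computability.MetaComplexity.IsPib.top {i : ℕ} : MetaComplexity.IsPib i (⊤ : Language.boundedArith.BoundedFormula α n) :=
  .of_isSharplyBounded (.of_isQF (IsQF.falsum.imp IsQF.falsum))

/-- `Πᵇᵢ₊₁` is closed under finite conjunctions `List.foldr (· ⊓ ·) ⊤`. [folklore] -/
theorem _root_.Literature.Computability.MetaComplexity.IsPib.foldr_inf {i : ℕ} (l : List (Language.boundedArith.BoundedFormula α n))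
    (hl : ∀ φ ∈ l, MetaComplexity.IsPib (i + 1) φ) : MetaComplexity.IsPib (i + 1) (l.foldr (· ⊓ ·) ⊤) := by
  induction l with
  | nil => exact MetaComplexity.IsPib.top
  | cons φ l ih =>
    simp only [List.foldr_cons]
    exact (hl φ (by simp)).inf (ih fun ψ hψ => hl ψ (by simp [hψ]))

/-- `Πᵇᵢ₊₁` is closed under the finite conjunction `BoundedFormula.iInf`. [folklore] -/
theorem _root_.Literature.Computability.MetaComplexity.IsPib.iInf {i : ℕ} {β : Type*} [Finite β]
    {f : β → Language.boundedArith.BoundedFormula α n} (hf : ∀ b, MetaComplexity.IsPib (i + 1) (f b)) :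
    MetaComplexity.IsPib (i + 1) (BoundedFormula.iInf f) := by
  unfold BoundedFormula.iInf
  refine MetaComplexity.IsPib.foldr_inf _ fun φ hφ => ?_
  simp only [List.mem_map, Finset.mem_toList, Finset.mem_univ, true_and] at hφ
  obtain ⟨b, rfl⟩ := hφ
  exact hf b

end ReindexClasses

/-! ## Maps preserving `Πᵇᵢ` formulas -/

/-- Restricting an extended assignment to the old variables. [folklore] -/
private theorem elim_snoc_comp_castSucc {M : Type*} {n : ℕ} (xs : Fin n → M) (a : M) :
    (Sum.elim (default : Empty → M) (Fin.snoc xs a : Fin (n + 1) → M)) ∘ Sum.inr ∘ Fin.castSucc =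
      xs := by
  funext k
  simp

section Preserve

variable {M N : Type} [Language.boundedArith.Structure M] [Language.boundedArith.Structure N]

/-- `PreservesPib i f`: the map `f : M → N` of structures for the language of bounded arithmetic
*preserves all `Πᵇᵢ` formulas*: for every `Πᵇᵢ` formula `φ(x₀,…,xₙ₋₁)` (free variables
represented by the in-context variables `Fin n`, as in `IsForallSigmab` and `⊨ᵇ`) and all
`ā ∈ Mⁿ`, `M ⊨ φ(ā)` implies `N ⊨ φ(f ā)`.  Equivalently `f` *reflects* all `Σᵇᵢ` formulas;
for an inclusion `M ⊆ N` this is implied by (and for `i ≥ 1` weaker than) "`N` is a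
`Σᵇᵢ`-elementary extension of `M`" (Krajíček 1995, §7.6). [cite: Krajicek1995, §7.6] -/
def PreservesPib (i : ℕ) (f : M → N) : Prop :=
  ∀ ⦃n : ℕ⦄ ⦃φ : Language.boundedArith.BoundedFormula Empty n⦄, MetaComplexity.IsPib i φ →
    ∀ xs : Fin n → M, φ.Realize default xs → φ.Realize default (f ∘ xs)

namespace PreservesPib

variable {i : ℕ} {f : M → N}

/-- The identity preserves `Πᵇᵢ` formulas. [folklore] -/
protected theorem id : PreservesPib i (_root_.id : M → M) := fun _ _ _ _ h => h

/-- Composition of `Πᵇᵢ`-preserving maps. [folklore] -/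
theorem comp {K : Type} [Language.boundedArith.Structure K] {g : N → K}
    (hg : PreservesPib i g) (hf : PreservesPib i f) : PreservesPib i (g ∘ f) :=
  fun _ _ hφ xs h => hg hφ (f ∘ xs) (hf hφ xs h)

/-- A `Πᵇᵢ`-preserving map preserves quantifier-free formulas. [folklore] -/
theorem realize_of_isQF (hf : PreservesPib i f) {n : ℕ}
    {φ : Language.boundedArith.BoundedFormula Empty n} (hφ : φ.IsQF) (xs : Fin n → M)
    (h : φ.Realize default xs) : φ.Realize default (f ∘ xs) :=
  hf (.of_isSharplyBounded (.of_isQF hφ)) xs h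

/-- A `Πᵇᵢ`-preserving map reflects `Σᵇᵢ` formulas (`i ≥ 1`). [folklore] -/
theorem reflects_isSigmab (hf : PreservesPib (i + 1) f) {n : ℕ}
    {φ : Language.boundedArith.BoundedFormula Empty n} (hφ : MetaComplexity.IsSigmab (i + 1) φ) (xs : Fin n → M)
    (h : φ.Realize default (f ∘ xs)) : φ.Realize default xs := by
  by_contra hx
  exact absurd h (hf hφ.not xs hx)

/-- A `Πᵇᵢ`-preserving map commutes with the evaluation of terms. [folklore] -/
theorem realize_term (hf : PreservesPib i f) {n : ℕ} (t : Language.boundedArith.Term (Fin n))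
    (xs : Fin n → M) : t.realize (f ∘ xs) = f (t.realize xs) := by
  let φ : Language.boundedArith.BoundedFormula Empty (n + 1) :=
    equal (t.relabel (Sum.inr ∘ Fin.castSucc)) (var (Sum.inr (Fin.last n)))
  have hφ : φ.IsQF := (IsAtomic.equal _ _).isQF
  have h1 : φ.Realize default (Fin.snoc xs (t.realize xs)) := by
    change (t.relabel (Sum.inr ∘ Fin.castSucc)).realize
        (Sum.elim (default : Empty → M) (Fin.snoc xs (t.realize xs))) =
      (Sum.elim (default : Empty → M) (Fin.snoc xs (t.realize xs))) (Sum.inr (Fin.last n))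
    rw [Term.realize_relabel, elim_snoc_comp_castSucc]
    simp
  have h2 := hf.realize_of_isQF hφ _ h1
  change (t.relabel (Sum.inr ∘ Fin.castSucc)).realize
      (Sum.elim (default : Empty → N) (f ∘ Fin.snoc xs (t.realize xs))) =
    (Sum.elim (default : Empty → N) (f ∘ Fin.snoc xs (t.realize xs))) (Sum.inr (Fin.last n)) at h2
  rw [Term.realize_relabel, Fin.comp_snoc, elim_snoc_comp_castSucc] at h2
  simpa using h2

/-- A `Πᵇᵢ`-preserving map is injective. [folklore] -/
theorem injective (hf : PreservesPib i f) : Function.Injective f := by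
  intro a b hab
  by_contra hne
  let φ : Language.boundedArith.BoundedFormula Empty 2 := ∼(equal (var (Sum.inr 0)) (var (Sum.inr 1)))
  have hφ : φ.IsQF := (IsAtomic.equal _ _).isQF.not
  have h := hf.realize_of_isQF hφ ![a, b] (by simpa [φ, Realize] using hne)
  simp [φ, Realize] at h
  exact h hab

/-- A `Πᵇᵢ`-preserving map commutes with the function symbols. [folklore] -/
theorem map_fun (hf : PreservesPib i f) {l : ℕ} (F : Language.boundedArith.Functions l)
    (x : Fin l → M) : f (Structure.funMap F x) = Structure.funMap F (f ∘ x) := by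
  have h := hf.realize_term (Term.func F Term.var) x
  simp only [Term.realize] at h
  exact h.symm

/-- A `Πᵇᵢ`-preserving map preserves and reflects the relation symbols. [folklore] -/
theorem map_rel (hf : PreservesPib i f) {l : ℕ} (R : Language.boundedArith.Relations l)
    (x : Fin l → M) : Structure.RelMap R (f ∘ x) ↔ Structure.RelMap R x := by
  constructor
  · intro h
    by_contra hx
    have h' := hf.realize_of_isQF (φ := ∼(rel R fun j => var (Sum.inr j)))
      ((IsAtomic.rel _ _).isQF.not) x (by simpa [Realize] using hx)
    simp only [Realize, Term.realize_var, Sum.elim_inr] at h'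
    exact h' h
  · intro h
    have h' := hf.realize_of_isQF (φ := rel R fun j => var (Sum.inr j))
      (IsAtomic.rel _ _).isQF x (by simpa [Realize] using h)
    simp only [Realize, Term.realize_var, Sum.elim_inr] at h'
    exact h'

/-- A `Πᵇᵢ`-preserving map is an embedding of structures. [folklore] -/
noncomputable def toEmbedding (hf : PreservesPib i f) : M ↪[Language.boundedArith] N where
  toFun := f
  inj' := hf.injective
  map_fun' := fun F x => hf.map_fun F x
  map_rel' := fun R x => hf.map_rel R x

/-- `hf.toEmbedding` is `f`. [folklore] -/
@[simp] theorem coe_toEmbedding (hf : PreservesPib i f) : ⇑hf.toEmbedding = f := rfl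

end PreservesPib

end Preserve

end Literature.Computability.Complexity

namespace Literature.Computability.Complexity

open MetaComplexity

/-! ## The model-theoretic form of Buss's theorem and the reduction -/

/-- **Model-theoretic form of Buss's conservation theorem** (named fact).  For every `i ≥ 1`,
every model `M` of `T₂ⁱ` admits a map `f : M → N` into a model `N` of `S₂ⁱ⁺¹` which preserves
all `Πᵇᵢ₊₁` formulas with parameters from `M` (so `N` is, up to isomorphism, an extension of
`M` reflecting `Σᵇᵢ₊₁` formulas).  This is the statement established by the model-theoretic
proofs of Buss's theorem — Krajíček 1995, Thm. 7.6.3 with pp. 116–117 (following Zambella 1996;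
first such proof by Wilkie, unpublished): every countable model of `PVᵢ₊₁ ⊇ T₂ⁱ` has a
`Σᵇᵢ₊₁`-elementary extension to a model of `S₂ⁱ⁺¹`, `PVᵢ₊₁` being conservative over `T₂ⁱ`
(Krajíček 1995, Thm. 5.3.5) — and it is *equivalent* to Buss's Thm. 5 as printed
(`t2_hasPibPreservingMap_S2_succ_iff` below, by compactness).  Structures range over `Type`, the
universe of the models in Mathlib's `⊨ᵇ` for this language.
[cite: BussContempMath1990, Thm. 5 (model-theoretic form)] [cite: Krajicek1995, Thm. 7.6.3 and pp. 116–117] -/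
def T2_hasPibPreservingMap_S2_succ : Prop :=
  ∀ ⦃i : ℕ⦄, 1 ≤ i → ∀ (M : Type) [Language.boundedArith.Structure M], M ⊨ T2 i →
    ∃ (N : Type) (_ : Language.boundedArith.Structure N) (f : M → N),
      N ⊨ S2 (i + 1) ∧ PreservesPib (i + 1) f

/-- Every structure for the language of bounded arithmetic is nonempty (it interprets `0`).
[folklore] -/
theorem nonempty_of_structure (N : Type*) [Language.boundedArith.Structure N] : Nonempty N :=
  ⟨Structure.funMap (L := Language.boundedArith) BoundedArithFunc.zero default⟩

/-- **Reduction.** The model-theoretic form implies Buss's conservation theorem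
`S2_succ_isConservativeOver_T2`: if `S₂ⁱ⁺¹ ⊨ ∀x̄ ψ(x̄)` with `ψ ∈ Σᵇᵢ₊₁` and `M ⊨ T₂ⁱ`, map `M`
`Πᵇᵢ₊₁`-preservingly into `N ⊨ S₂ⁱ⁺¹`; then `N ⊨ ψ(f ā)` for all `ā ∈ M`, and `¬ψ ∈ Πᵇᵢ₊₁` is
preserved by `f`, so `M ⊨ ψ(ā)` (Krajíček 1995, p. 116–117; Zambella 1996). [cite: Krajicek1995, pp. 116–117] -/
theorem S2_succ_isConservativeOver_T2_of_hasPibPreservingMap (H : T2_hasPibPreservingMap_S2_succ) :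
    S2_succ_isConservativeOver_T2 := by
  intro i hi φ hφ hS
  obtain ⟨n, ψ, hψ, rfl⟩ := hφ
  rw [Theory.models_sentence_iff]
  intro M
  obtain ⟨N, _, f, hN, hf⟩ := H hi M M.is_model
  haveI : Nonempty N := nonempty_of_structure N
  haveI : N ⊨ S2 (i + 1) := hN
  have hNψ : N ⊨ ψ.alls := hS.realize_sentence N
  simp only [Sentence.Realize, realize_alls] at hNψ ⊢
  intro xs
  by_contra hx
  have h1 : (∼ψ).Realize (default : Empty → M) xs := hx
  have h2 := hf hψ.not xs h1
  exact h2 (hNψ (f ∘ xs))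

/-! ## The converse: from conservativity to the model-theoretic form -/

section Converse

variable {α : Type}

/-- A model of `T` together with the sentences about new constants `α` obtained from a set `S`
of formulas yields a model of `T` and an assignment of `α` realizing `S` (reduct and the
interpretation of the constants); stated for the language of bounded arithmetic, whose models in
`⊨ᵇ` live in `Type`. [folklore] -/
private theorem exists_realize_of_isSatisfiable (T : Language.boundedArith.Theory)
    (S : Set (Language.boundedArith.Formula α))
    (h : ((Language.boundedArith.lhomWithConstants α).onTheory T ∪
      Formula.equivSentence '' S).IsSatisfiable) :
    ∃ (N : Type) (_ : Language.boundedArith.Structure N) (_ : Nonempty N) (v : α → N),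
      N ⊨ T ∧ ∀ φ ∈ S, φ.Realize v := by
  obtain ⟨N⟩ := h
  letI : Language.boundedArith.Structure N := (Language.boundedArith.lhomWithConstants α).reduct N
  have hT : N ⊨ (Language.boundedArith.lhomWithConstants α).onTheory T :=
    N.is_model.mono Set.subset_union_left
  have hS : N ⊨ Formula.equivSentence '' S := N.is_model.mono Set.subset_union_right
  refine ⟨N, inferInstance, inferInstance, fun a => (Language.boundedArith.con a : N),
    (LHom.onTheory_model _ T).1 hT, fun φ hφ => ?_⟩
  exact (Formula.realize_equivSentence N φ).1 (hS.realize_of_mem _ (Set.mem_image_of_mem _ hφ))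

/-- The formula with parameters `φ(ā)` (`ā ∈ Mⁿ` plugged in for the context variables of
`φ`), as a formula whose free variables are indexed by `M`. [folklore] -/
def withParams {M : Type} {n : ℕ} (φ : Language.boundedArith.BoundedFormula Empty n)
    (xs : Fin n → M) : Language.boundedArith.Formula M :=
  Formula.relabel (Sum.elim Empty.elim xs) φ.toFormula

/-- Semantics of `withParams`: under an interpretation `w` of the parameters, `φ(ā)` holds iff
`φ` holds at `w ∘ ā`. [folklore] -/
@[simp] theorem realize_withParams {M : Type} {N : Type*} [Language.boundedArith.Structure N]
    {n : ℕ} (φ : Language.boundedArith.BoundedFormula Empty n) (xs : Fin n → M) (w : M → N) :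
    (withParams φ xs).Realize w ↔ φ.Realize default (w ∘ xs) := by
  rw [withParams, Formula.realize_relabel, realize_toFormula,
    Subsingleton.elim ((w ∘ Sum.elim Empty.elim xs) ∘ Sum.inl) default]
  rfl

/-- **Converse reduction** (compactness and the `Πᵇᵢ₊₁`-diagram).  Buss's conservation theorem
implies its model-theoretic form: given `M ⊨ T₂ⁱ`, the theory
`S₂ⁱ⁺¹ ∪ {φ(ā) : φ ∈ Πᵇᵢ₊₁, M ⊨ φ(ā)}` is finitely satisfiable — a failure on finitely many
`φⱼ(āⱼ)` would make `S₂ⁱ⁺¹ ⊢ ∀z̄ ¬⋀ⱼ φⱼ(z̄)`, a `∀Σᵇᵢ₊₁` sentence, hence provable in `T₂ⁱ` and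
true in `M`, contradicting `M ⊨ ⋀ⱼ φⱼ(āⱼ)` — and any model of it, with the interpretation of the
constants, is the required `Πᵇᵢ₊₁`-preserving map (the argument of Krajíček 1995, pp. 116–117,
read backwards; standard). [cite: Krajicek1995, pp. 116–117] -/
theorem t2_hasPibPreservingMap_S2_succ_of_isConservativeOver (hC : S2_succ_isConservativeOver_T2) :
    T2_hasPibPreservingMap_S2_succ := by
  intro i hi M _ hM
  classical
  haveI : M ⊨ T2 i := hM
  haveI : Nonempty M := nonempty_of_structure M
  -- the `Πᵇᵢ₊₁`-diagram of `M`
  let S : Set (Language.boundedArith.Formula M) :=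
    {χ | ∃ (n : ℕ) (φ : Language.boundedArith.BoundedFormula Empty n) (xs : Fin n → M),
      IsPib (i + 1) φ ∧ φ.Realize default xs ∧ χ = withParams φ xs}
  have hsat : ((Language.boundedArith.lhomWithConstants M).onTheory (S2 (i + 1)) ∪
      Formula.equivSentence '' S).IsSatisfiable := by
    rw [Theory.isSatisfiable_iff_isFinitelySatisfiable]
    intro T0 hT0
    by_contra hns
    -- the diagram sentences occurring in `T0`, with their data
    let J : Type := {σ : ↥T0 // (σ : Language.boundedArith[[M]].Sentence) ∈ Formula.equivSentence '' S}
    have hJ : ∀ j : J, ∃ d : (Σ n : ℕ, Language.boundedArith.BoundedFormula Empty n × (Fin n → M)),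
        IsPib (i + 1) d.2.1 ∧ d.2.1.Realize default d.2.2 ∧
          ((j : ↥T0) : Language.boundedArith[[M]].Sentence) =
            Formula.equivSentence (withParams d.2.1 d.2.2) := by
      rintro ⟨⟨σ, hσ⟩, hσS⟩
      obtain ⟨χ, ⟨n, φ, xs, h1, h2, rfl⟩, hχσ⟩ := hσS
      exact ⟨⟨n, φ, xs⟩, h1, h2, hχσ.symm⟩
    choose d hdP hdR hdE using hJ
    -- the finitely many parameters involved, enumerated by `Fin m`
    let P : Finset M := Finset.univ.biUnion fun j : J => Finset.univ.image (d j).2.2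
    have hmemP : ∀ (j : J) (k : Fin (d j).1), (d j).2.2 k ∈ P := fun j k =>
      Finset.mem_biUnion.2 ⟨j, Finset.mem_univ _, Finset.mem_image.2 ⟨k, Finset.mem_univ _, rfl⟩⟩
    let m : ℕ := P.card
    let e : ↥P ≃ Fin m := P.equivFin
    let ι : ∀ j : J, Fin (d j).1 → Fin m := fun j k => e ⟨(d j).2.2 k, hmemP j k⟩
    -- the conjunction of the reindexed `φⱼ`, a `Πᵇᵢ₊₁` formula in `m` variables
    let Ψ : Language.boundedArith.BoundedFormula Empty m :=
      BoundedFormula.iInf fun j : J => ((d j).2.1).reindex (ι j)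
    have hΨ : IsPib (i + 1) Ψ := IsPib.iInf fun j => (hdP j).reindex (ι j)
    -- (A) `S₂ⁱ⁺¹ ⊢ ∀ z̄ ¬Ψ(z̄)`: a model of `S₂ⁱ⁺¹` with `Ψ(ȳ)` would be a model of `T0`
    have hA : S2 (i + 1) ⊨ᵇ (∼Ψ).alls := by
      rw [Theory.models_sentence_iff]
      intro K
      simp only [Sentence.Realize, realize_alls, realize_not]
      intro ys hys
      obtain ⟨k₀⟩ := (inferInstance : Nonempty K)
      let w : M → K := fun a => if h : a ∈ P then ys (e ⟨a, h⟩) else k₀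
      have hw : ∀ j : J, w ∘ (d j).2.2 = ys ∘ ι j := fun j => funext fun k => by
        simp [w, ι, dif_pos (hmemP j k)]
      letI : (constantsOn M).Structure K := constantsOn.structure w
      have hK : K ⊨ (T0 : Language.boundedArith[[M]].Theory) := by
        refine ⟨fun σ hσ => ?_⟩
        rcases hT0 hσ with hσ₁ | hσ₂
        · have hKS : K ⊨ (Language.boundedArith.lhomWithConstants M).onTheory (S2 (i + 1)) :=
            (LHom.onTheory_model _ _).2 K.is_model
          exact hKS.realize_of_mem σ hσ₁
        · let j : J := ⟨⟨σ, hσ⟩, hσ₂⟩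
          have hσj : σ = Formula.equivSentence (withParams (d j).2.1 (d j).2.2) := hdE j
          rw [hσj, Formula.realize_equivSentence]
          change (withParams (d j).2.1 (d j).2.2).Realize w
          rw [realize_withParams, hw j, ← realize_reindex]
          exact realize_iInf.1 hys j
      exact hns (Theory.Model.isSatisfiable K)
    -- (B) by conservativity `T₂ⁱ ⊢ ∀ z̄ ¬Ψ(z̄)`, but `M ⊨ Ψ(ā)` at the original parameters
    have hB : T2 i ⊨ᵇ (∼Ψ).alls := hC hi _ ⟨m, ∼Ψ, hΨ.not, rfl⟩ hA
    have hBM : M ⊨ (∼Ψ).alls := hB.realize_sentence M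
    simp only [Sentence.Realize, realize_alls, realize_not] at hBM
    refine hBM (fun p => ((e.symm p : ↥P) : M)) (realize_iInf.2 fun j => ?_)
    rw [realize_reindex]
    have hys : (fun p => ((e.symm p : ↥P) : M)) ∘ ι j = (d j).2.2 := funext fun k => by
      simp [ι]
    rw [hys]
    exact hdR j
  obtain ⟨N, _, _, v, hN, hv⟩ := exists_realize_of_isSatisfiable (S2 (i + 1)) S hsat
  refine ⟨N, inferInstance, v, hN, fun n φ hφ xs hx => ?_⟩
  have h := hv (withParams φ xs) ⟨n, φ, xs, hφ, hx, rfl⟩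
  rwa [realize_withParams] at h

/-- **Buss's conservation theorem ⟺ its model-theoretic form.**  `S₂ⁱ⁺¹` is
`∀Σᵇᵢ₊₁`-conservative over `T₂ⁱ` for all `i ≥ 1` (Buss 1990, Thm. 5) if and only if every model
of `T₂ⁱ` maps `Πᵇᵢ₊₁`-preservingly into a model of `S₂ⁱ⁺¹` for all `i ≥ 1` (Krajíček 1995,
Thm. 7.6.3 / Zambella 1996 form).  Both directions are proved above.
[cite: BussContempMath1990, Thm. 5] [cite: Krajicek1995, Thm. 7.6.3 and pp. 116–117] -/
theorem t2_hasPibPreservingMap_S2_succ_iff :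
    T2_hasPibPreservingMap_S2_succ ↔ S2_succ_isConservativeOver_T2 :=
  ⟨S2_succ_isConservativeOver_T2_of_hasPibPreservingMap,
    t2_hasPibPreservingMap_S2_succ_of_isConservativeOver⟩

end Converse

end Literature.Computability.Complexity
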